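import Mathlib
import HarnessLib
import Summits.HubbardSuperconductivity.HubbardSuperconductivity.Theorems.KLProgrammeKLRegimeVolumeLimitLastScaleDefectDoor
import Literature.MathematicalPhysics.QuantumLattice.HubbardDiagonalQuadraticResummation
import Literature.MathematicalPhysics.QuantumLattice.HubbardDiagonalQuadraticEffAction

/-!
# Route `KLProgramme` — crux K3, VL child `KLRegimeVolumeLimitV17F2` (stmt-HubbardSuperconductivity-20440): THE REGISTERED STUB TEXT FROM THE
# LAST-SCALE RESUMMED SELF-ENERGIES AT THE FIELD LEVEL (read-out currency left free)
# (cell gate-hubbard-kl, seat hubbard-kl-k3c5-p3 g9, technique «OS-positivity-free direct assembly»)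

Sequel of `…VolumeLimitLastScaleDefectDoor`.  There the hypothesis is the pinned two-leg GRID defect of the resummed grid actions (k3c5-p2's β′ currency,
read through `…TwoVolumeMomentumReadoutPin`).  ROUTE A's (A3) at the sectorised scales (k3c4-p1 g8, VL-STUB-ROUTE-A-g8.md §3 (viii)) may prefer to read
out in ANOTHER currency (sector-field kernels via `map S`, or directly at the field level).  This file therefore states the door one level up, at the
FIELD level, with NO representation chosen: by the K-resummed reading [tree] `klSelfEnergy_eq_resummed` (FST 1996 §1),
`Σ^{K}_L(i,k,σ) = E_K(p_k) + τ_K(p_k)·Σ̃^{K}_L(i,k,σ)`, `Σ̃^{K}_L = selfEnergy (effAction (normalCovariance p̃^{K}_L) V_U)` the self-energy of the PURELY QUARTIC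
resummed theory; so the stub text follows from «`‖Σ̃^{K_L}_L((ω,k),0)‖ ≤ B` and `‖Σ̃^{K_L}_L((ω,k),0) − Σ̃^{K_{L″}}_{L″}((ω,k″),0)‖ ≤ δ L → 0` at a common lattice
momentum, eventually, per label» + unit framed partition functions, the symbol terms being handled exactly as in the grid door (uniform continuity of
`(κ,e) ↦ E, τ` on a compact + the tower's frame comparability).

* §0 `isUnit_effPartitionFn_framed_of_resummed` — the `IsUnit` inputs of both doors from the resummed quartic partition function (the two-volume pass's
  native output): `Z_C(V + 𝒩_K) = Π(1 + pκ)·Z_{C̃}(V)`;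
* **`framedNestedFlowTextV17F2_of_lastScaleResummedText`** — the stub text from the field-level hypothesis;
* `volumeLimitTextV17F2_of_lastScaleResummedText` — the VL child text.

Proofs only; no definition.  References: BGM 2006 §2.4 (2.38); FST 1996 §1.
-/

noncomputable section

namespace Summit.HubbardSuperconductivity.HubbardSuperconductivity.Theorems.TwoPointAssembly

set_option linter.dupNamespace false -- summit = problem name (single-conjunct summit), D-0017

open Finset Filter Topology Literature.MathematicalPhysics.QuantumLattice GrassmannAlgebra Literature.Probability.LatticeModels
open Summit.HubbardSuperconductivity.HubbardSuperconductivity.Theorems.KLRegimeSplit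
open Summit.HubbardSuperconductivity.HubbardSuperconductivity.Theorems.KLProgrammeLegKernels
open Summit.HubbardSuperconductivity.HubbardSuperconductivity.Theorems.TwoVolumeDefect

/-! ## §0 The unit framed partition function from the resummed one -/

section Units

variable {L M : ℕ} [NeZero L] [NeZero M]

/-- **The framed (undressed) partition function is a unit as soon as the RESUMMED quartic one is**: for the normal covariance with symbol
`p = uvSymbolCT … K Λ` (`1 + pκ ≠ 0` always, [tree] `one_add_uvSymbolCT_mul_ne_zero`), `Z_C(V + 𝒩_K) = Π(1 + pκ) · Z_{C̃}(V)`
([tree] `effPartitionFn_normalCovariance_add_diagQuadratic`, `effPartitionFn_normalCovariance_diagQuadratic`) — so the `IsUnit` inputs of the doors of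
this file and of `…LastScaleDefectDoor` follow from the native output of the two-volume pass (the unit partition function of the resummed theory).
[cite: FeldmanSalmhoferTrubowitz1996, §1] -/
theorem isUnit_effPartitionFn_framed_of_resummed {β : ℝ} (hβ : 0 < β) (μ : ℝ) (K : TrigPolyC4v) (Λ : ℝ) {V : HubbardGrassmann L M}
    (hV0 : constPart ℂ V = 0)
    (hZV : IsUnit (effPartitionFn ℂ (normalCovariance L M (fun ks => uvSymbolCT L M β μ K Λ ks /
      (1 + uvSymbolCT L M β μ K Λ ks * ((K.eval (latticeMomentum L ks.1.2) / (β * (L : ℝ) ^ 2) : ℝ) : ℂ)))) V)) :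
    IsUnit (effPartitionFn ℂ (normalCovariance L M (uvSymbolCT L M β μ K Λ)) (V + counterQuadratic L M β K)) := by
  have hden : ∀ ks : FreqMomentum L M × Fin 2,
      1 + uvSymbolCT L M β μ K Λ ks * ((K.eval (latticeMomentum L ks.1.2) / (β * (L : ℝ) ^ 2) : ℝ) : ℂ) ≠ 0 :=
    fun ks => one_add_uvSymbolCT_mul_ne_zero hβ μ K Λ ks
  -- the counterterm vertex as a diagonal pair sum (k3c4-p2's `TwoVolumeDefect.counterQuadratic_eq_sum_smul`, inlined to keep the import cone small)
  have hQ : counterQuadratic L M β K = ∑ ks : FreqMomentum L M × Fin 2,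
      ((K.eval (latticeMomentum L ks.1.2) / (β * (L : ℝ) ^ 2) : ℝ) : ℂ) •
        (gen ℂ ((ks, 0) : HubbardFieldIdx L M) * gen ℂ ((ks, 1) : HubbardFieldIdx L M)) := by
    rw [counterQuadratic]
    symm
    rw [Fintype.sum_prod_type]
    rfl
  rw [effPartitionFn_normalCovariance_add_diagQuadratic (uvSymbolCT L M β μ K Λ)
      (fun ks => ((K.eval (latticeMomentum L ks.1.2) / (β * (L : ℝ) ^ 2) : ℝ) : ℂ)) hden hQ hV0,
    hQ, effPartitionFn_normalCovariance_diagQuadratic _ _ hden]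
  exact (isUnit_iff_ne_zero.2 (Finset.prod_ne_zero_iff.2 fun ks _ => hden ks)).mul hZV

end Units

/-- **THE STUB TEXT OF «cauchy v8-F2» FROM THE LAST-SCALE RESUMMED SELF-ENERGIES (field level, read-out currency free).**  See the module docstring.
[cite: BenfattoGiulianiMastropietro2006, §2.4 (2.38)] -/
theorem framedNestedFlowTextV17F2_of_lastScaleResummedText
    (hD : ∀ (G : GeoConsts) (P : SplitConsts) (Q : EngConsts) (R : RenConsts), G.WF → P.WF → Q.WF → R.WF →
      ∃ c₅ : ℝ, 0 < c₅ ∧ ∀ c : ℝ, 0 < c → c ≤ c₅ → ∃ U₀ : ℝ, 0 < U₀ ∧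
        ∀ μ ∈ klWindowC, ∀ U : ℝ, 0 < U → U ≤ U₀ → ∀ β : ℝ, klBetaMin ≤ β → β ≤ Real.exp (c / U ^ 2) →
          ∀ K : TrigPolyC4v, klPredsV17F2.frameOK R U (nScales β) μ K →
            ∀ (Lstar : ℕ) (Mstar : ℕ → ℕ), TowerP klPredsV17F2 G P Q R β U μ K Lstar Mstar →
              ∀ n : ℤ, ∃ L₀ : ℕ, ∃ B : ℝ, ∃ δ : ℕ → ℝ, Tendsto δ atTop (𝓝 0) ∧
                ∀ (L : ℕ) [NeZero L], L₀ ≤ L → ∀ (L'' : ℕ) [NeZero L''], L ∣ L'' → ∃ M₀ : ℕ, ∀ (M : ℕ) [NeZero M], M₀ ≤ M →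
                  IsUnit (effPartitionFn ℂ (normalCovariance L M (uvSymbolCT L M β μ (klFlowFrameU L M β U μ (nScales β + 1))
                    (klScale klE0 (nScales β + 1))))
                    (hubbardInteraction L M β U + counterQuadratic L M β (klFlowFrameU L M β U μ (nScales β + 1)))) ∧
                  IsUnit (effPartitionFn ℂ (normalCovariance L'' M (uvSymbolCT L'' M β μ (klFlowFrameU L'' M β U μ (nScales β + 1))
                    (klScale klE0 (nScales β + 1))))
                    (hubbardInteraction L'' M β U + counterQuadratic L'' M β (klFlowFrameU L'' M β U μ (nScales β + 1)))) ∧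
                  ∀ ω : MatsubaraIdx M, matsubaraInt M ω = n → ∀ (k : TorusSite 2 L) (k'' : TorusSite 2 L''),
                    latticeMomentum L'' k'' = latticeMomentum L k →
                      ‖selfEnergy L M β (effAction ℂ (normalCovariance L M (fun ks =>
                          uvSymbolCT L M β μ (klFlowFrameU L M β U μ (nScales β + 1)) (klScale klE0 (nScales β + 1)) ks /
                            (1 + uvSymbolCT L M β μ (klFlowFrameU L M β U μ (nScales β + 1)) (klScale klE0 (nScales β + 1)) ks *
                              (((klFlowFrameU L M β U μ (nScales β + 1)).eval (latticeMomentum L ks.1.2) / (β * (L : ℝ) ^ 2) : ℝ) : ℂ))))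
                          (hubbardInteraction L M β U)) (ω, k) 0‖ ≤ B ∧
                      ‖selfEnergy L M β (effAction ℂ (normalCovariance L M (fun ks =>
                          uvSymbolCT L M β μ (klFlowFrameU L M β U μ (nScales β + 1)) (klScale klE0 (nScales β + 1)) ks /
                            (1 + uvSymbolCT L M β μ (klFlowFrameU L M β U μ (nScales β + 1)) (klScale klE0 (nScales β + 1)) ks *
                              (((klFlowFrameU L M β U μ (nScales β + 1)).eval (latticeMomentum L ks.1.2) / (β * (L : ℝ) ^ 2) : ℝ) : ℂ))))
                          (hubbardInteraction L M β U)) (ω, k) 0 -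
                        selfEnergy L'' M β (effAction ℂ (normalCovariance L'' M (fun ks =>
                          uvSymbolCT L'' M β μ (klFlowFrameU L'' M β U μ (nScales β + 1)) (klScale klE0 (nScales β + 1)) ks /
                            (1 + uvSymbolCT L'' M β μ (klFlowFrameU L'' M β U μ (nScales β + 1)) (klScale klE0 (nScales β + 1)) ks *
                              (((klFlowFrameU L'' M β U μ (nScales β + 1)).eval (latticeMomentum L'' ks.1.2) / (β * (L'' : ℝ) ^ 2) : ℝ) : ℂ))))
                          (hubbardInteraction L'' M β U)) (ω, k'') 0‖ ≤ δ L) :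
    ∀ (G : GeoConsts) (P : SplitConsts) (Q : EngConsts) (R : RenConsts), G.WF → P.WF → Q.WF → R.WF →
      ∃ c₅ : ℝ, 0 < c₅ ∧ ∀ c : ℝ, 0 < c → c ≤ c₅ → ∃ U₀ : ℝ, 0 < U₀ ∧
        ∀ μ ∈ klWindowC, ∀ U : ℝ, 0 < U → U ≤ U₀ → ∀ β : ℝ, klBetaMin ≤ β → β ≤ Real.exp (c / U ^ 2) →
          ∀ K : TrigPolyC4v, klPredsV17F2.frameOK R U (nScales β) μ K →
            ∀ (Lstar : ℕ) (Mstar : ℕ → ℕ), TowerP klPredsV17F2 G P Q R β U μ K Lstar Mstar →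
              ∀ n : ℤ, ∃ L₀ : ℕ, ∃ ρ : ℕ → ℝ, Tendsto ρ atTop (𝓝 0) ∧
                ∀ (L : ℕ) [NeZero L], L₀ ≤ L → ∀ (L'' : ℕ) [NeZero L''], L ∣ L'' → ∃ M₀ : ℕ, ∀ (M : ℕ) [NeZero M], M₀ ≤ M →
                  ∀ (ω : MatsubaraIdx M), matsubaraInt M ω = n → ∀ (k : TorusSite 2 L) (k'' : TorusSite 2 L''),
                    latticeMomentum L'' k'' = latticeMomentum L k →
                      ‖klSelfEnergy L M β U μ (klFlowFrameU L M β U μ (nScales β + 1)) klE0 (nScales β + 1) (ω, k) 0 -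
                          klSelfEnergy L'' M β U μ (klFlowFrameU L'' M β U μ (nScales β + 1)) klE0 (nScales β + 1) (ω, k'') 0‖ ≤ ρ L := by
  intro G P Q R hG hP hQ hR
  obtain ⟨c₅, hc₅, hc⟩ := hD G P Q R hG hP hQ hR
  refine ⟨c₅, hc₅, fun c hc0 hcc => ?_⟩
  obtain ⟨U₀, hU₀, hU⟩ := hc c hc0 hcc
  refine ⟨U₀, hU₀, fun μ hμ U hU0 hUU β hβmin hβmax K hK Lstar Mstar hT n => ?_⟩
  have hβ : 0 < β := pos_of_klBetaMin_le hβmin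
  obtain ⟨L₀D, B, δ, hδ, hDn⟩ := hU μ hμ U hU0 hUU β hβmin hβmax K hK Lstar Mstar hT n
  -- fixed data at fixed `β`: the last scale, the frequency of the label, the symbol boxes
  have hΛ : 0 < klScale klE0 (nScales β + 1) := klth_klScale_pos _
  set ν : ℝ := Real.pi * (2 * (n : ℝ) + 1) / β with hν_def
  have hν : ν ≠ 0 := by
    have h2 : (2 * (n : ℝ) + 1) ≠ 0 := by
      have : (2 * (n : ℝ) + 1) = ((2 * n + 1 : ℤ) : ℝ) := by push_cast; ring
      rw [this]
      exact_mod_cast (by omega : (2 * n + 1 : ℤ) ≠ 0)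
    rw [hν_def]
    exact div_ne_zero (mul_ne_zero Real.pi_ne_zero h2) hβ.ne'
  set Kmax : ℝ := max 0 (∑ m ∈ range (nScales β + 1), R.Gfr 0 * uPow 0 U * (4 : ℝ) ^ ((((0 : ℕ) : ℤ) - 2) * (m : ℤ))) with hKmax_def
  set Cfr : ℝ := |∑ m ∈ range (nScales β + 1), Q.CL β m| with hCfr_def
  have hCfr : 0 ≤ Cfr := abs_nonneg _
  set emax : ℝ := 4 + |μ| with hemax_def
  -- the explicit symbols as continuous functions of `(κ, e)`
  set Φu : ℝ × ℝ → ℂ := fun q => uvSymbolFn 1 (klScale klE0 (nScales β + 1)) (q.2 - q.1) ν with hΦu_def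
  set ΦE : ℝ × ℝ → ℂ := fun q => (q.1 : ℂ) - (q.1 : ℂ) ^ 2 * (Φu q / (1 + Φu q * (q.1 : ℂ))) with hΦE_def
  set Φτ : ℝ × ℝ → ℂ := fun q => (1 - (q.1 : ℂ) * (Φu q / (1 + Φu q * (q.1 : ℂ)))) ^ 2 with hΦτ_def
  have hcu : Continuous Φu :=
    (continuous_uvSymbolFn_band 1 hΛ ν).comp (continuous_snd.sub continuous_fst)
  have hden : ∀ q : ℝ × ℝ, (1 : ℂ) + Φu q * (q.1 : ℂ) ≠ 0 := fun q =>
    one_add_uvSymbolFn_mul_ne_zero hν 1 (klScale klE0 (nScales β + 1)) _ _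
  have hc1 : Continuous fun q : ℝ × ℝ => (q.1 : ℂ) := Complex.continuous_ofReal.comp continuous_fst
  have hcq : Continuous fun q : ℝ × ℝ => Φu q / (1 + Φu q * (q.1 : ℂ)) := hcu.div (continuous_const.add (hcu.mul hc1)) hden
  have hcE : Continuous ΦE := hc1.sub ((hc1.pow 2).mul hcq)
  have hcτ : Continuous Φτ := (continuous_const.sub (hc1.mul hcq)).pow 2
  set S : Set (ℝ × ℝ) := Set.Icc (-Kmax) Kmax ×ˢ Set.Icc (-emax) emax with hS_def
  have hS : IsCompact S := isCompact_Icc.prod isCompact_Icc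
  have hUE : UniformContinuousOn ΦE S := hS.uniformContinuousOn_of_continuous hcE.continuousOn
  have hUτ : UniformContinuousOn Φτ S := hS.uniformContinuousOn_of_continuous hcτ.continuousOn
  obtain ⟨CE, hCE⟩ := hS.exists_bound_of_continuousOn hcE.continuousOn
  obtain ⟨Cτ, hCτ⟩ := hS.exists_bound_of_continuousOn hcτ.continuousOn
  have hKmax0 : 0 ≤ Kmax := le_max_left _ _
  have hemax0 : 0 ≤ emax := by positivity
  have h0S : ((0 : ℝ), (0 : ℝ)) ∈ S := ⟨⟨by linarith, hKmax0⟩, ⟨by linarith, hemax0⟩⟩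
  have hCτ0 : 0 ≤ Cτ := (norm_nonneg _).trans (hCτ _ h0S)
  -- one null rate for each symbol term
  obtain ⟨ηE, hηE, hηEP⟩ := exists_rate_of_forall_eps
    (P := fun (L : ℕ) (ε : ℝ) => ∀ κ κ' e : ℝ, |κ| ≤ Kmax → |κ'| ≤ Kmax → |e| ≤ emax → |κ - κ'| ≤ Cfr / L → ‖ΦE (κ, e) - ΦE (κ', e)‖ ≤ ε)
    (B := CE + CE)
    (fun L κ κ' e hκ hκ' he _ => (norm_sub_le _ _).trans
      (add_le_add (hCE _ ⟨abs_le.1 hκ, abs_le.1 he⟩) (hCE _ ⟨abs_le.1 hκ', abs_le.1 he⟩)))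
    (fun ε hε => exists_threshold_of_uniformContinuousOn hUE hCfr hε)
  obtain ⟨ητ, hητ, hητP⟩ := exists_rate_of_forall_eps
    (P := fun (L : ℕ) (ε : ℝ) => ∀ κ κ' e : ℝ, |κ| ≤ Kmax → |κ'| ≤ Kmax → |e| ≤ emax → |κ - κ'| ≤ Cfr / L → ‖Φτ (κ, e) - Φτ (κ', e)‖ ≤ ε)
    (B := Cτ + Cτ)
    (fun L κ κ' e hκ hκ' he _ => (norm_sub_le _ _).trans
      (add_le_add (hCτ _ ⟨abs_le.1 hκ, abs_le.1 he⟩) (hCτ _ ⟨abs_le.1 hκ', abs_le.1 he⟩)))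
    (fun ε hε => exists_threshold_of_uniformContinuousOn hUτ hCfr hε)
  -- the rate and the thresholds
  refine ⟨max L₀D Lstar, fun L => ηE L + ητ L * B + Cτ * δ L, ?_, fun L _ hL L'' _ hdvd => ?_⟩
  · have h := (hηE.add (hητ.mul_const B)).add (hδ.const_mul Cτ)
    simpa using h
  have hL₀ : L₀D ≤ L := (le_max_left _ _).trans hL
  have hLs : Lstar ≤ L := (le_max_right _ _).trans hL
  have hLL'' : L ≤ L'' := Nat.le_of_dvd (Nat.pos_of_ne_zero (NeZero.ne L'')) hdvd
  have hLs'' : Lstar ≤ L'' := hLs.trans hLL''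
  obtain ⟨M₀D, hM₀D⟩ := hDn L hL₀ L'' hdvd
  refine ⟨max M₀D (max (max (Mstar L) (Mstar L'')) (max (Q.M0 β L) (Q.M0 β L''))), fun M _ hM ω hω k k'' hk => ?_⟩
  have hM₀ : M₀D ≤ M := (le_max_left _ _).trans hM
  have hM₁ : Mstar L ≤ M := (le_max_left _ _).trans ((le_max_left _ _).trans ((le_max_right _ _).trans hM))
  have hM₁'' : Mstar L'' ≤ M := (le_max_right _ _).trans ((le_max_left _ _).trans ((le_max_right _ _).trans hM))
  have hM₂ : Q.M0 β L ≤ M := (le_max_left _ _).trans ((le_max_right _ _).trans ((le_max_right _ _).trans hM))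
  have hM₂'' : Q.M0 β L'' ≤ M := (le_max_right _ _).trans ((le_max_right _ _).trans ((le_max_right _ _).trans hM))
  obtain ⟨hZc, hZf, hw⟩ := hM₀D M hM₀
  obtain ⟨hBω, hDefω⟩ := hw ω hω k k'' hk
  -- the resummed reading at both volumes
  have hνeq : matsubaraFreq β M ω = ν := by rw [matsubaraFreq, hω]
  set p : Fin 2 → ℝ := latticeMomentum L k with hp_def
  set κ : ℝ := (klFlowFrameU L M β U μ (nScales β + 1)).eval p with hκ_def
  set κ' : ℝ := (klFlowFrameU L'' M β U μ (nScales β + 1)).eval p with hκ'_def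
  set e : ℝ := -2 * (∑ l : Fin 2, Real.cos (p l)) - μ with he_def
  have huc : uvSymbolCT L M β μ (klFlowFrameU L M β U μ (nScales β + 1)) (klScale klE0 (nScales β + 1)) ((ω, k), 0) =
      ((β * (L : ℝ) ^ 2 : ℝ) : ℂ) * Φu (κ, e) := by
    rw [uvSymbolCT_eq_mul_sampled hβ μ _ _ ω k 0, hνeq]
  have huf : uvSymbolCT L'' M β μ (klFlowFrameU L'' M β U μ (nScales β + 1)) (klScale klE0 (nScales β + 1)) ((ω, k''), 0) =
      ((β * (L'' : ℝ) ^ 2 : ℝ) : ℂ) * Φu (κ', e) := by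
    rw [uvSymbolCT_eq_mul_sampled hβ μ _ _ ω k'' 0, hνeq, hk]
  have hreadc := klSelfEnergy_eq_resummed hβ U μ (klFlowFrameU L M β U μ (nScales β + 1)) (nScales β + 1) ω k 0 hZc (Φu (κ, e)) huc
  have hreadf := klSelfEnergy_eq_resummed hβ U μ (klFlowFrameU L'' M β U μ (nScales β + 1)) (nScales β + 1) ω k'' 0 hZf (Φu (κ', e)) huf
  rw [hk] at hreadf
  rw [hreadc, hreadf, resummed_two_frames_split]
  -- the symbol data at this momentum
  have hκ : |κ| ≤ Kmax := (abs_eval_klFlowFrameU_le_of_towerV17F2 hT hLs hM₁ le_rfl p).trans (le_max_right _ _)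
  have hκ' : |κ'| ≤ Kmax := (abs_eval_klFlowFrameU_le_of_towerV17F2 hT hLs'' hM₁'' le_rfl p).trans (le_max_right _ _)
  have he : |e| ≤ emax := by
    rw [he_def, hemax_def]
    have hc : |∑ l : Fin 2, Real.cos (p l)| ≤ 2 := by
      refine (Finset.abs_sum_le_sum_abs _ _).trans ?_
      have : ∑ l : Fin 2, |Real.cos (p l)| ≤ ∑ _l : Fin 2, (1 : ℝ) := Finset.sum_le_sum fun l _ => Real.abs_cos_le_one _
      simpa using this
    calc |-2 * (∑ l : Fin 2, Real.cos (p l)) - μ| ≤ |-2 * ∑ l : Fin 2, Real.cos (p l)| + |μ| := abs_sub _ _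
      _ = 2 * |∑ l : Fin 2, Real.cos (p l)| + |μ| := by rw [abs_mul, abs_neg, abs_two]
      _ ≤ 4 + |μ| := by linarith
  have hLpos : (0 : ℝ) < L := by exact_mod_cast Nat.pos_of_ne_zero (NeZero.ne L)
  have hd : |κ - κ'| ≤ Cfr / L :=
    (flowFrames_twoVolume_of_towerV17F2 hμ hT hLs hLL'' hM₁ hM₂ hM₁'' hM₂'' le_rfl p).trans
      (div_le_div_of_nonneg_right (le_abs_self _) hLpos.le)
  have hT1 : ‖ΦE (κ, e) - ΦE (κ', e)‖ ≤ ηE L := hηEP L κ κ' e hκ hκ' he hd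
  have hT2 : ‖Φτ (κ, e) - Φτ (κ', e)‖ ≤ ητ L := hητP L κ κ' e hκ hκ' he hd
  have hT3 : ‖Φτ (κ', e)‖ ≤ Cτ := hCτ _ ⟨abs_le.1 hκ', abs_le.1 he⟩
  refine (norm_add_le _ _).trans (add_le_add ((norm_add_le _ _).trans (add_le_add hT1 ?_)) ?_)
  · rw [norm_mul]
    exact mul_le_mul hT2 hBω (norm_nonneg _) ((norm_nonneg _).trans hT2)
  · rw [norm_mul]
    exact mul_le_mul hT3 hDefω (norm_nonneg _) hCτ0

/-- **The VL child text from the last-scale resummed self-energies** (∘ `volumeLimitTextV17F2_of_framedNestedFlowText`). [cite: BenfattoGiulianiMastropietro2006, §2.4 (2.38)] -/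
theorem volumeLimitTextV17F2_of_lastScaleResummedText
    (hD : ∀ (G : GeoConsts) (P : SplitConsts) (Q : EngConsts) (R : RenConsts), G.WF → P.WF → Q.WF → R.WF →
      ∃ c₅ : ℝ, 0 < c₅ ∧ ∀ c : ℝ, 0 < c → c ≤ c₅ → ∃ U₀ : ℝ, 0 < U₀ ∧
        ∀ μ ∈ klWindowC, ∀ U : ℝ, 0 < U → U ≤ U₀ → ∀ β : ℝ, klBetaMin ≤ β → β ≤ Real.exp (c / U ^ 2) →
          ∀ K : TrigPolyC4v, klPredsV17F2.frameOK R U (nScales β) μ K →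
            ∀ (Lstar : ℕ) (Mstar : ℕ → ℕ), TowerP klPredsV17F2 G P Q R β U μ K Lstar Mstar →
              ∀ n : ℤ, ∃ L₀ : ℕ, ∃ B : ℝ, ∃ δ : ℕ → ℝ, Tendsto δ atTop (𝓝 0) ∧
                ∀ (L : ℕ) [NeZero L], L₀ ≤ L → ∀ (L'' : ℕ) [NeZero L''], L ∣ L'' → ∃ M₀ : ℕ, ∀ (M : ℕ) [NeZero M], M₀ ≤ M →
                  IsUnit (effPartitionFn ℂ (normalCovariance L M (uvSymbolCT L M β μ (klFlowFrameU L M β U μ (nScales β + 1))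
                    (klScale klE0 (nScales β + 1))))
                    (hubbardInteraction L M β U + counterQuadratic L M β (klFlowFrameU L M β U μ (nScales β + 1)))) ∧
                  IsUnit (effPartitionFn ℂ (normalCovariance L'' M (uvSymbolCT L'' M β μ (klFlowFrameU L'' M β U μ (nScales β + 1))
                    (klScale klE0 (nScales β + 1))))
                    (hubbardInteraction L'' M β U + counterQuadratic L'' M β (klFlowFrameU L'' M β U μ (nScales β + 1)))) ∧
                  ∀ ω : MatsubaraIdx M, matsubaraInt M ω = n → ∀ (k : TorusSite 2 L) (k'' : TorusSite 2 L''),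
                    latticeMomentum L'' k'' = latticeMomentum L k →
                      ‖selfEnergy L M β (effAction ℂ (normalCovariance L M (fun ks =>
                          uvSymbolCT L M β μ (klFlowFrameU L M β U μ (nScales β + 1)) (klScale klE0 (nScales β + 1)) ks /
                            (1 + uvSymbolCT L M β μ (klFlowFrameU L M β U μ (nScales β + 1)) (klScale klE0 (nScales β + 1)) ks *
                              (((klFlowFrameU L M β U μ (nScales β + 1)).eval (latticeMomentum L ks.1.2) / (β * (L : ℝ) ^ 2) : ℝ) : ℂ))))
                          (hubbardInteraction L M β U)) (ω, k) 0‖ ≤ B ∧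
                      ‖selfEnergy L M β (effAction ℂ (normalCovariance L M (fun ks =>
                          uvSymbolCT L M β μ (klFlowFrameU L M β U μ (nScales β + 1)) (klScale klE0 (nScales β + 1)) ks /
                            (1 + uvSymbolCT L M β μ (klFlowFrameU L M β U μ (nScales β + 1)) (klScale klE0 (nScales β + 1)) ks *
                              (((klFlowFrameU L M β U μ (nScales β + 1)).eval (latticeMomentum L ks.1.2) / (β * (L : ℝ) ^ 2) : ℝ) : ℂ))))
                          (hubbardInteraction L M β U)) (ω, k) 0 -
                        selfEnergy L'' M β (effAction ℂ (normalCovariance L'' M (fun ks =>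
                          uvSymbolCT L'' M β μ (klFlowFrameU L'' M β U μ (nScales β + 1)) (klScale klE0 (nScales β + 1)) ks /
                            (1 + uvSymbolCT L'' M β μ (klFlowFrameU L'' M β U μ (nScales β + 1)) (klScale klE0 (nScales β + 1)) ks *
                              (((klFlowFrameU L'' M β U μ (nScales β + 1)).eval (latticeMomentum L'' ks.1.2) / (β * (L'' : ℝ) ^ 2) : ℝ) : ℂ))))
                          (hubbardInteraction L'' M β U)) (ω, k'') 0‖ ≤ δ L) :
    VolumeLimitP2 klPredsV17F2 FinalTwoLegVolLimitEx klWindowC :=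
  volumeLimitTextV17F2_of_framedNestedFlowText (framedNestedFlowTextV17F2_of_lastScaleResummedText hD)

end Summit.HubbardSuperconductivity.HubbardSuperconductivity.Theorems.TwoPointAssembly
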